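import Mathlib
import Summits.Ventures.PercRepro.RankLevelSetTriangleStar
import Summits.Ventures.PercRepro.TriangleCapGraphArith

/-!
# PercRepro — the matroid closed form reduced to the minimum-cocircuit gain bound (p3, gen 25)

CONJECTURE 10b of the triangle-cap lane (proofs/P3-TRIANGLE-CAP.md §10b): every finite simple matroid with
(C1) (lines have `≤ 3` points), (C2) (planes `≤ 6`) and (C3) (rank-`4` flats `≤ 10`) of nullity `ν` has at most
`P_KK(ν)` triangles (`3`-element circuits).  §10o reduces it to ONE local lemma, the **minimum-cocircuit gain
bound**: for a cocircuit `K` of minimum size `d` (so that `M.E \ K` is a largest hyperplane), the number of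
triangles meeting `K` is at most `min (C(d,2)) ν`.  This file is the kernel form of that reduction:

* `Core3 M` — the class (simple + (C1) + (C2) + (C3)); `Core3.restrict` — it passes to restrictions;
* `gain M K` — the triangles of `M` not inside `M.E \ K` (the ones meeting the cocircuit `K`);
* `MinCocircuitGainBound α` — the candidate lemma as a proposition (NOT proved here; exhaustive to `9` elements);
* `ncard_triangles_eq_restrict_add_gain` — `T(M) = T(M ↾ (M.E \ K)) + gain M K`;
* `eRk_compl_add_one_eq_eRank` — for a cocircuit `K`, `r(M.E \ K) + 1 = r(M)` (the complement is a hyperplane);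
* `exists_min_cocircuit` — a finite matroid with a cocircuit has one of minimum size;
* `ExistsGoodCocircuit α` — the weaker hypothesis the induction actually uses: every finite matroid of the class
  with a triangle has SOME cocircuit `K` with `gain M K ≤ min (C(|K|,2)) ν`;
* **`ncard_triangles_le_P_of_existsGoodCocircuit`** — `ExistsGoodCocircuit α → T(M) ≤ P_KK ν` for every finite
  `M` in the class with `|E| = r(E) + ν`: induction on `|E|`, restrict to the hyperplane `M.E \ K` (nullity
  `ν − (d − 1)`, the class inherited), and close by `KK.L2'` (`min (C(d,2)) ν + P (ν − (d − 1)) ≤ P ν`,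
  TriangleCapGraphArith);
* `existsGoodCocircuit_of_minCocircuitGainBound`, **`ncard_triangles_le_P_of_minCocircuitGainBound`** — the
  same from the candidate lemma (a minimum cocircuit exists).

Both closed-form theorems are CONDITIONAL on their named hypothesis by construction; nothing here claims the
candidate lemma (the paper record and the census are in P3-TRIANGLE-CAP.md §10o). Axioms: standard.
-/

open scoped Matroid

namespace PercRepro

namespace TriangleCap

namespace Cocirc

open Set

variable {α : Type}

/-- The class of the closed form: simple, (C1), (C2), (C3). -/
structure Core3 (M : Matroid α) : Prop where
  simple : ∀ e ∈ M.E, ∀ f ∈ M.E, e ≠ f → M.eRk {e, f} = 2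
  c1 : ∀ L ⊆ M.E, M.eRk L = 2 → L.ncard ≤ 3
  c2 : ∀ P ⊆ M.E, M.eRk P ≤ 3 → P.ncard ≤ 6
  c3 : ∀ X ⊆ M.E, M.eRk X ≤ 4 → X.ncard ≤ 10

/-- The class passes to restrictions (the rank of a subset of `R` is unchanged in `M ↾ R`). -/
theorem Core3.restrict {M : Matroid α} (h : Core3 M) {R : Set α} (hR : R ⊆ M.E) :
    Core3 (M ↾ R) where
  simple e he f hf hef := by
    rw [Matroid.restrict_ground_eq] at he hf
    rw [Matroid.restrict_eRk_eq _ (pair_subset he hf)]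
    exact h.simple e (hR he) f (hR hf) hef
  c1 L hL hr := by
    rw [Matroid.restrict_ground_eq] at hL
    rw [Matroid.restrict_eRk_eq _ hL] at hr
    exact h.c1 L (hL.trans hR) hr
  c2 P hP hr := by
    rw [Matroid.restrict_ground_eq] at hP
    rw [Matroid.restrict_eRk_eq _ hP] at hr
    exact h.c2 P (hP.trans hR) hr
  c3 X hX hr := by
    rw [Matroid.restrict_ground_eq] at hX
    rw [Matroid.restrict_eRk_eq _ hX] at hr
    exact h.c3 X (hX.trans hR) hr

/-- The gain of a set `K`: the triangles of `M` not inside `M.E \ K` — for a cocircuit `K`, exactly the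
triangles meeting `K` (in two or three points). -/
noncomputable def gain (M : Matroid α) (K : Set α) : ℕ :=
  {C ∈ ThmN.triangles M | ¬ C ⊆ M.E \ K}.ncard

/-- **The minimum-cocircuit gain bound** (the candidate lemma of P3-TRIANGLE-CAP.md §10o) as a proposition:
in every finite matroid of the class, every cocircuit `K` of minimum size satisfies
`gain M K ≤ min (C(|K|, 2)) ν` where `|E| = r(E) + ν`. -/
def MinCocircuitGainBound (α : Type) : Prop :=
  ∀ (M : Matroid α) [M.Finite], Core3 M → ∀ K : Set α, M.IsCocircuit K →
    (∀ K' : Set α, M.IsCocircuit K' → K.ncard ≤ K'.ncard) →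
    ∀ ν : ℕ, M.E.encard = M.eRank + ν → gain M K ≤ min (K.ncard.choose 2) ν

/-- The hypothesis the induction uses: every finite matroid of the class with a triangle has SOME cocircuit
`K` whose gain is at most `min (C(|K|, 2)) ν`. -/
def ExistsGoodCocircuit (α : Type) : Prop :=
  ∀ (M : Matroid α) [M.Finite], Core3 M → (ThmN.triangles M).Nonempty →
    ∀ ν : ℕ, M.E.encard = M.eRank + ν →
      ∃ K : Set α, M.IsCocircuit K ∧ gain M K ≤ min (K.ncard.choose 2) ν

/-- The triangles of a restriction are the triangles inside the restricted set. -/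
theorem triangles_restrict (M : Matroid α) {R : Set α} (hR : R ⊆ M.E) :
    ThmN.triangles (M ↾ R) = {C ∈ ThmN.triangles M | C ⊆ R} := by
  ext C
  simp only [ThmN.triangles, mem_setOf_eq, Matroid.restrict_isCircuit_iff hR]
  tauto

/-- `T(M) = T(M ↾ (M.E \ K)) + gain M K`. -/
theorem ncard_triangles_eq_restrict_add_gain (M : Matroid α) [M.Finite] (K : Set α) :
    (ThmN.triangles M).ncard = (ThmN.triangles (M ↾ (M.E \ K))).ncard + gain M K := by
  have hTfin : (ThmN.triangles M).Finite :=
    M.ground_finite.finite_subsets.subset (fun C hC => hC.1.subset_ground)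
  rw [triangles_restrict M sdiff_subset, gain]
  have h1 : {C ∈ ThmN.triangles M | C ⊆ M.E \ K} = ThmN.triangles M ∩ {C | C ⊆ M.E \ K} := rfl
  have h2 : {C ∈ ThmN.triangles M | ¬ C ⊆ M.E \ K} = ThmN.triangles M \ {C | C ⊆ M.E \ K} := rfl
  rw [h1, h2, ncard_inter_add_ncard_sdiff_eq_ncard _ _ hTfin]

/-- For a cocircuit `K`, the complement `M.E \ K` is not spanning but `insert e (M.E \ K)` is, for every
`e ∈ K`; hence `r(M.E \ K) + 1 = r(M)`. -/
theorem eRk_compl_add_one_eq_eRank (M : Matroid α) [M.Finite] {K : Set α} (hK : M.IsCocircuit K) :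
    M.eRk (M.E \ K) + 1 = M.eRank := by
  have hKE : K ⊆ M.E := hK.subset_ground
  obtain ⟨e, heK⟩ := hK.nonempty
  have hmin := Matroid.isCocircuit_iff_minimal_compl_nonspanning.1 hK
  have hns : ¬ M.Spanning (M.E \ K) := hmin.1
  -- `K \ {e}` is a proper subset of the minimal `K`, so its complement is spanning
  have hsp : M.Spanning (M.E \ (K \ {e})) := by
    by_contra h
    have hle : K ⊆ K \ {e} := hmin.2 h sdiff_subset
    exact (hle heK).2 (mem_singleton e)
  have hset : M.E \ (K \ {e}) = insert e (M.E \ K) := by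
    ext x
    simp only [mem_sdiff, mem_singleton_iff, mem_insert_iff, not_and, not_not]
    constructor
    · rintro ⟨hxE, hx⟩
      by_cases hxK : x ∈ K
      · exact Or.inl (hx hxK)
      · exact Or.inr ⟨hxE, hxK⟩
    · rintro (rfl | ⟨hxE, hxK⟩)
      · exact ⟨hKE heK, fun _ => rfl⟩
      · exact ⟨hxE, fun h => absurd h hxK⟩
  rw [hset] at hsp
  have h1 : M.eRank ≤ M.eRk (M.E \ K) + 1 := by
    rw [← hsp.eRk_eq]
    exact M.eRk_insert_le_add_one e _
  have h2 : M.eRk (M.E \ K) < M.eRank :=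
    lt_of_not_ge fun h => hns ((Matroid.spanning_iff_eRk_le sdiff_subset).2 h)
  have hne : M.eRk (M.E \ K) ≠ ⊤ :=
    ((M.eRk_le_encard _).trans_lt (M.ground_finite.subset sdiff_subset).encard_lt_top).ne
  exact le_antisymm ((ENat.add_one_le_iff hne).2 h2) h1

/-- A finite matroid with a cocircuit has a cocircuit of minimum size. -/
theorem exists_min_cocircuit (M : Matroid α) [M.Finite] (h : ∃ K, M.IsCocircuit K) :
    ∃ K, M.IsCocircuit K ∧ ∀ K', M.IsCocircuit K' → K.ncard ≤ K'.ncard := by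
  have hfin : {K | M.IsCocircuit K}.Finite :=
    M.ground_finite.finite_subsets.subset (fun K hK => hK.subset_ground)
  obtain ⟨K, hK, hmin⟩ := Set.exists_min_image {K | M.IsCocircuit K} Set.ncard hfin h
  exact ⟨K, hK, fun K' hK' => hmin K' hK'⟩

/-- A matroid with a triangle has positive rank, hence a cocircuit. -/
theorem exists_cocircuit_of_triangle (M : Matroid α) {C : Set α} (hC : C ∈ ThmN.triangles M) :
    ∃ K, M.IsCocircuit K := by
  rw [← Matroid.rankPos_iff_exists_isCocircuit]
  refine ⟨fun hB => ?_⟩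
  have h1 := hB.encard_eq_eRank
  have h2 := hC.1.eRk_add_one_eq
  have h3 : M.eRk C ≤ M.eRank := M.eRk_le_eRank C
  rw [← h1] at h3
  simp only [encard_empty, nonpos_iff_eq_zero] at h3
  rw [h3, zero_add] at h2
  have : C.ncard = 3 := hC.2
  have hCfin : C.Finite := by
    by_contra hinf
    rw [Set.Infinite.ncard hinf] at this
    omega
  rw [← hCfin.cast_ncard_eq, this] at h2
  exact absurd h2 (by decide)

/-- **The reduction.** If every finite matroid of the class with a triangle has a cocircuit of gain
`≤ min (C(d,2)) ν`, then every finite matroid of the class with `|E| = r(E) + ν` has at most `P_KK ν`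
triangles (induction on `|E|`: restrict to the hyperplane `M.E \ K`, close by `KK.L2'`). -/
theorem ncard_triangles_le_P_of_existsGoodCocircuit (hGB : ExistsGoodCocircuit α)
    (M : Matroid α) [M.Finite] (hM : Core3 M) {ν : ℕ} (hν : M.E.encard = M.eRank + ν) :
    (ThmN.triangles M).ncard ≤ KK.P ν := by
  suffices H : ∀ n : ℕ, ∀ (M : Matroid α) [M.Finite], M.E.ncard = n → Core3 M →
      ∀ ν : ℕ, M.E.encard = M.eRank + ν → (ThmN.triangles M).ncard ≤ KK.P ν from
    H _ M rfl hM ν hν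
  intro n
  induction n using Nat.strong_induction_on with
  | _ n ih =>
  intro M _ hn hM ν hν
  by_cases hT : (ThmN.triangles M).Nonempty
  swap
  · rw [Set.not_nonempty_iff_eq_empty] at hT
    rw [hT, ncard_empty]
    exact Nat.zero_le _
  obtain ⟨K, hK, hg⟩ := hGB M hM hT ν hν
  have hHE : M.E \ K ⊆ M.E := sdiff_subset
  have hKE : K ⊆ M.E := hK.subset_ground
  have hEfin := M.ground_finite
  have hHfin : (M.E \ K).Finite := hEfin.subset hHE
  have hKfin : K.Finite := hEfin.subset hKE
  haveI : (M ↾ (M.E \ K)).Finite := Matroid.restrict_finite hHfin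
  have hrk := eRk_compl_add_one_eq_eRank M hK
  have hRne : M.eRank ≠ ⊤ := ((M.eRank_le_encard_ground).trans_lt hEfin.encard_lt_top).ne
  obtain ⟨r, hr⟩ := ENat.ne_top_iff_exists.1 hRne
  have hrne : M.eRk (M.E \ K) ≠ ⊤ := ((M.eRk_le_encard _).trans_lt hHfin.encard_lt_top).ne
  obtain ⟨rH, hrH⟩ := ENat.ne_top_iff_exists.1 hrne
  have hEcard : M.E.encard = (M.E \ K).encard + K.encard := by
    rw [← encard_union_eq disjoint_sdiff_left, sdiff_union_of_subset hKE]
  have hrHle : M.eRk (M.E \ K) ≤ (M.E \ K).encard := M.eRk_le_encard _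
  rw [← hr, ← hrH] at hrk
  rw [← hr, hEcard, ← hHfin.cast_ncard_eq, ← hKfin.cast_ncard_eq] at hν
  rw [← hrH, ← hHfin.cast_ncard_eq] at hrHle
  have hrk' : rH + 1 = r := by exact_mod_cast hrk
  have hν' : (M.E \ K).ncard + K.ncard = r + ν := by exact_mod_cast hν
  have hrHle' : rH ≤ (M.E \ K).ncard := by exact_mod_cast hrHle
  have hd1 : 1 ≤ K.ncard := (ncard_pos hKfin).2 hK.nonempty
  have hdν : K.ncard - 1 ≤ ν := by omega
  -- the nullity of the restriction to the hyperplane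
  have hν2 : (M ↾ (M.E \ K)).E.encard = (M ↾ (M.E \ K)).eRank + ((ν - (K.ncard - 1) : ℕ) : ℕ∞) := by
    rw [Matroid.restrict_ground_eq, Matroid.eRank_restrict, ← hrH, ← hHfin.cast_ncard_eq]
    have : (M.E \ K).ncard = rH + (ν - (K.ncard - 1)) := by omega
    rw [this]
    push_cast
    rfl
  have hlt : (M.E \ K).ncard < n := by
    rw [← hn]
    exact ncard_lt_ncard (hKE.sdiff_ssubset_of_nonempty hK.nonempty) hEfin
  have ih' := ih _ hlt (M ↾ (M.E \ K)) rfl (hM.restrict hHE) _ hν2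
  rw [ncard_triangles_eq_restrict_add_gain M K]
  calc (ThmN.triangles (M ↾ (M.E \ K))).ncard + gain M K
      ≤ KK.P (ν - (K.ncard - 1)) + min (K.ncard.choose 2) ν := Nat.add_le_add ih' hg
    _ = min (K.ncard.choose 2) ν + KK.P (ν - (K.ncard - 1)) := Nat.add_comm _ _
    _ ≤ KK.P ν := KK.L2' K.ncard ν hd1 hdν

/-- The minimum-cocircuit gain bound supplies the good cocircuit: a minimum cocircuit (which exists as soon
as there is a triangle). -/
theorem existsGoodCocircuit_of_minCocircuitGainBound (h : MinCocircuitGainBound α) :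
    ExistsGoodCocircuit α := by
  intro M _ hM hT ν hν
  obtain ⟨C, hC⟩ := hT
  obtain ⟨K, hK, hKmin⟩ := exists_min_cocircuit M (exists_cocircuit_of_triangle M hC)
  exact ⟨K, hK, h M hM K hK hKmin ν hν⟩

/-- **CONJECTURE 10b modulo the candidate lemma.** Under the minimum-cocircuit gain bound, every finite
matroid of the class with `|E| = r(E) + ν` has at most `P_KK ν` triangles. -/
theorem ncard_triangles_le_P_of_minCocircuitGainBound (hGB : MinCocircuitGainBound α)
    (M : Matroid α) [M.Finite] (hM : Core3 M) {ν : ℕ} (hν : M.E.encard = M.eRank + ν) :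
    (ThmN.triangles M).ncard ≤ KK.P ν :=
  ncard_triangles_le_P_of_existsGoodCocircuit (existsGoodCocircuit_of_minCocircuitGainBound hGB) M hM hν

end Cocirc

end TriangleCap

end PercRepro
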